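import Mathlib.GroupTheory.QuotientGroup.Basic
import Mathlib.GroupTheory.Index
import Mathlib.Algebra.Module.Torsion.Basic
import HarnessLib

/-!
# The algebra of the defect count (C): the kernel of a character on `F × D`, and the kernel of
# `p^ν·ψ` on a subgroup transverse to `ker ψ` (cell `b2b-bsdres`, CLASS-CLOSURE lane, class O10 —
# x1b GEN 36, class lead; file 56 of the series: brick B7 of the global count (C) as PURE ALGEBRA,
# with its inputs displayed)

HONEST FRAMING (cell `b2b-bsdres`, run/shared/lean/b2b/bsd-rank1-residual/, verbatim in every
file): the goal of the cell is to DELETE the COMBINATION-SHAPED residual classes of the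
Birch–Swinnerton-Dyer formula for ALL analytic-rank `≤ 1` elliptic curves over `ℚ` — "full BSD
formula for every rank `≤ 1` curve in class `C`" assembled STRICTLY from published theorems — so
that the rank-`≤ 1` remainder becomes exactly the CONSTRUCTION-SHAPED classes, which are TYPED
(missing-input `Prop`s), NOT attempted. This is not "finishing BSD". CLASS-CLOSURE lane: prove
what is provable now; shrink each hard class to its core with data; no claim beyond stated classes;
research routes on CONSTRUCTION-SHAPED X12 / O10; census / instrument output = EVIDENCE / conjecture
items, NEVER a Literature fact; `RESIDUAL-MAP.md` marks change only by signed lines. THIS FILE: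
TOOL THEOREMS ONLY (abelian-group bookkeeping) — no definition, no named Literature fact, no
Summits-side fact `def … : Prop`, no `sorry`, axioms standard; nothing is booked; no label / mark /
count / sub-cell moves; (C1_η), (C2_η-GZ), (C3_η) stay typed as filed (cc-typer-6's pen); O10 stays
OPEN / CONSTRUCTION-SHAPED; nothing about `BSD(W, p)` of any pair is claimed.

## What (x1b GEN 31 `C3ETA-TRANSVERSALITY-x1b.md` §4, GEN 35 `B2-LOCALISATION-x1b.md` §3)

The defect `A₀ ⧸ S₀` of the exact bottom-layer control (B1 ⊕ B2, files 42–49, 55) embeds into the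
product of the level-`0` receptacles `F × D`, `F = ∏_{ℓ ∈ S, ℓ ≠ p} 𝒦_{ℓ,0}[p^∞]` (finite, of
order `∏ p^{ord_p c_ℓ}` — B4, files 50–54) and `D = C_∞` (the level-`∞` signed Kummer classes at `p`;
B3: `≅ ℚ_p/ℤ_p`), and Poitou–Tate duality (B5, the tree's `poitouTate_selmerStructure_duality`)
with `H¹(G_S, T_pW) = ℤ_p κ(P_W)` (B6) says that its image is the KERNEL of the character
`ρ = ∑_v ⟨·, loc_v κ(P_W)⟩_v` on `F × D`, whose restriction to `D` is `p^ν · ψ` for the character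
`ψ = ⟨·, κ(Q)⟩_p` with `ker ψ =` the Kummer line `L` (`loc_p κ(P_W) = p^ν κ(Q)`, `Q` a local
generator). THIS FILE proves the two pieces of pure algebra that turn these inputs into the COUNT
`#(A₀ ⧸ S₀) = #F · p^ν`:

* `natCard_ker_eq_card_mul_natCard_ker_inr` — for `ρ : F × D →+ Q` with `ρ(F × 0) ⊆ ρ(0 × D)`:
  **`#ker ρ = #F · #ker(ρ|_D)`** (the projection `ker ρ → F` is onto with kernel `ker(ρ|_D)`);
  `_of_surjective` — the hypothesis from `ρ|_D` onto.
* `mem_ker_nsmul_comp_subtype_iff` / `ker_nsmul_comp_subtype_eq` — for `ψ : H →+ Q`, `C ≤ H` with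
  `C ⊓ ker ψ = ⊥` (TRANSVERSALITY, the kernel theorem of gens 31–34 for `C = C⁻_η`, `ker ψ = L`):
  **`ker((k·ψ)|_C) = C[k]`**; hence `natCard_ker_nsmul_comp_subtype_eq` `#ker((k·ψ)|_C) = #C[k]`
  — so B3 enters (C) EXACTLY through `#C_∞[p^ν] = p^ν`.
* `natCard_ker_eq_card_mul_natCard_torsionBy` — the two combined:
  **`#ker ρ = #F · #C[k]`** for `ρ = ρ_F + (k·ψ)|_C` with `ρ_F(F) ⊆ (k·ψ)(C)`.

NOT here: B3, B5, B6 themselves (the inputs above); the embedding `A₀ ⧸ S₀ ↪ F × D` as a group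
homomorphism (B2 is in the tree in membership form, file 47).

References: [GreenbergLNM1716] R. Greenberg, LNM 1716 (1999), §4 (proof of Thm. 4.1, pp. 98–103:
the Cassels–Poitou–Tate count of `ker g₀`); [Kobayashi2003] Thm. 6.2 (p. 11), Thm. 9.3 (p. 26).
-/

namespace Summit.BirchSwinnertonDyer.Rank1Residual.Additive

namespace DefectCount

/-! ## §1 The kernel of a character on `F × D` -/

section Product

variable {F D Q : Type*} [AddCommGroup F] [AddCommGroup D] [AddCommGroup Q] (ρ : F × D →+ Q)

/-- **`#ker ρ = #F · #ker(ρ|_D)`** for `ρ : F × D →+ Q` with `ρ(F × 0) ⊆ ρ(0 × D)` (`Nat.card`; both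
sides `0` when infinite): the projection `ker ρ → F` is onto (for `f` pick `d` with
`ρ(f, 0) = ρ(0, d)`; then `(f, −d) ∈ ker ρ`) and its kernel is `ker(ρ ∘ inr)`. The shape of the
Cassels–Poitou–Tate count of the control defect: `F` the finite product of the `ℓ ≠ p` receptacles,
`D` the receptacle at `p`. [cite: GreenbergLNM1716, §4 (pp. 98–103)] -/
theorem natCard_ker_eq_card_mul_natCard_ker_inr (h : ∀ f : F, ∃ d : D, ρ (f, 0) = ρ (0, d)) :
    Nat.card ρ.ker = Nat.card F * Nat.card (ρ.comp (AddMonoidHom.inr F D)).ker := by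
  set π : ρ.ker →+ F := (AddMonoidHom.fst F D).comp ρ.ker.subtype with hπ
  have hπapp : ∀ x : ρ.ker, π x = (x : F × D).1 := fun _ => rfl
  -- `π` is onto
  have hsurj : Function.Surjective π := by
    intro f
    obtain ⟨d, hd⟩ := h f
    refine ⟨⟨(f, -d), ?_⟩, rfl⟩
    rw [AddMonoidHom.mem_ker]
    have h1 : ((f, -d) : F × D) = (f, 0) + (0, -d) := by simp
    have h2 : ((0, -d) : F × D) = -(0, d) := by simp
    rw [h1, map_add, h2, map_neg, hd, add_neg_cancel]
  -- `ker π ≃ ker(ρ ∘ inr)`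
  have e : π.ker ≃ (ρ.comp (AddMonoidHom.inr F D)).ker :=
    { toFun := fun x => ⟨((x : ρ.ker) : F × D).2, by
        have hx : ((x : ρ.ker) : F × D).1 = 0 := by rw [← hπapp]; exact x.2
        have hk : ρ ((x : ρ.ker) : F × D) = 0 := (x : ρ.ker).2
        rw [AddMonoidHom.mem_ker, AddMonoidHom.comp_apply, AddMonoidHom.inr_apply]
        have : ((x : ρ.ker) : F × D) = (0, ((x : ρ.ker) : F × D).2) := Prod.ext hx rfl
        rw [← this]
        exact hk⟩
      invFun := fun d => ⟨⟨(0, (d : D)), by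
        have hd := d.2
        rw [AddMonoidHom.mem_ker, AddMonoidHom.comp_apply, AddMonoidHom.inr_apply] at hd
        exact hd⟩, by rw [AddMonoidHom.mem_ker, hπapp]⟩
      left_inv := fun x => by
        have hx : ((x : ρ.ker) : F × D).1 = 0 := by rw [← hπapp]; exact x.2
        apply Subtype.ext; apply Subtype.ext
        exact Prod.ext hx.symm rfl
      right_inv := fun d => by rfl }
  rw [AddSubgroup.card_eq_card_quotient_mul_card_addSubgroup π.ker,
    Nat.card_congr (QuotientAddGroup.quotientKerEquivOfSurjective π hsurj).toEquiv, Nat.card_congr e]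

/-- The hypothesis `ρ(F × 0) ⊆ ρ(0 × D)` from SURJECTIVITY of `ρ|_D` (the case of (C): `ρ|_D` is
`p^ν` times a character of `C_∞ ≅ ℚ_p/ℤ_p` with finite kernel, hence onto `ℚ_p/ℤ_p`).
[cite: GreenbergLNM1716, §4 (pp. 98–103)] -/
theorem natCard_ker_eq_card_mul_natCard_ker_inr_of_surjective
    (h : Function.Surjective (ρ.comp (AddMonoidHom.inr F D))) :
    Nat.card ρ.ker = Nat.card F * Nat.card (ρ.comp (AddMonoidHom.inr F D)).ker :=
  natCard_ker_eq_card_mul_natCard_ker_inr ρ fun f => by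
    obtain ⟨d, hd⟩ := h (ρ (f, 0))
    exact ⟨d, by rw [← hd, AddMonoidHom.comp_apply, AddMonoidHom.inr_apply]⟩

end Product

/-! ## §2 The kernel of `k·ψ` on a subgroup transverse to `ker ψ` -/

section Transverse

variable {H Q : Type*} [AddCommGroup H] [AddCommGroup Q] (ψ : H →+ Q) (C : AddSubgroup H)

/-- **Transversality turns `ker((k·ψ)|_C)` into `C[k]`**: if `C ⊓ ker ψ = ⊥` then for `x ∈ C`,
`k • ψ x = 0 ↔ k • x = 0` (`k • ψ x = ψ (k • x)`, and `k • x ∈ C ∩ ker ψ = 0`). In (C): `ψ = ⟨·, κ(Q)⟩_p`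
with `ker ψ` the Kummer line, `C = C⁻_η` the minus condition, `k = p^ν` — the local constant
`u(p) = 0` of the (C3_η) anatomy. [cite: Kobayashi2003, Thm. 6.2 (p. 11) and Prop. 8.12 (p. 17)] -/
theorem nsmul_apply_eq_zero_iff_of_inf_ker_eq_bot (hC : C ⊓ ψ.ker = ⊥) (k : ℕ) {x : H}
    (hx : x ∈ C) : k • ψ x = 0 ↔ k • x = 0 := by
  rw [← map_nsmul]
  constructor
  · intro h
    have hmem : k • x ∈ C ⊓ ψ.ker :=
      ⟨C.nsmul_mem hx k, (AddMonoidHom.mem_ker).mpr h⟩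
    rw [hC, AddSubgroup.mem_bot] at hmem
    exact hmem
  · intro h
    rw [h, map_zero]

/-- Membership form: `x ∈ ker((k·ψ) ∘ C.subtype) ↔ k • x = 0` under `C ⊓ ker ψ = ⊥`. [folklore] -/
theorem mem_ker_nsmul_comp_subtype_iff (hC : C ⊓ ψ.ker = ⊥) (k : ℕ) (x : C) :
    x ∈ ((k • ψ).comp C.subtype).ker ↔ k • x = 0 := by
  rw [AddMonoidHom.mem_ker, AddMonoidHom.comp_apply, AddMonoidHom.nsmul_apply, C.subtype_apply,
    nsmul_apply_eq_zero_iff_of_inf_ker_eq_bot ψ C hC k x.2]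
  exact ⟨fun h => Subtype.ext (by exact_mod_cast h), fun h => by rw [← AddSubgroupClass.coe_nsmul, h]; rfl⟩

/-- **`ker((k·ψ)|_C) = C[k]`** (as subgroups of `C`) under `C ⊓ ker ψ = ⊥`. [folklore] -/
theorem ker_nsmul_comp_subtype_eq (hC : C ⊓ ψ.ker = ⊥) (k : ℕ) :
    ((k • ψ).comp C.subtype).ker = AddSubgroup.torsionBy C k := by
  ext x
  rw [mem_ker_nsmul_comp_subtype_iff ψ C hC k x, AddSubgroup.torsionBy.nsmul_iff]

/-- **`#ker((k·ψ)|_C) = #C[k]`** under `C ⊓ ker ψ = ⊥`: brick B3 enters the count (C) EXACTLY through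
the order of `C_∞[p^ν]` (`= p^ν` when `C_∞ ≅ ℚ_p/ℤ_p`, Kobayashi Thm. 6.2).
[cite: Kobayashi2003, Thm. 6.2 (p. 11)] -/
theorem natCard_ker_nsmul_comp_subtype_eq (hC : C ⊓ ψ.ker = ⊥) (k : ℕ) :
    Nat.card ((k • ψ).comp C.subtype).ker = Nat.card (AddSubgroup.torsionBy C k) := by
  rw [ker_nsmul_comp_subtype_eq ψ C hC k]

end Transverse

/-! ## §3 The two combined: `#ker ρ = #F · #C[k]` -/

section Combined

variable {F H Q : Type*} [AddCommGroup F] [AddCommGroup H] [AddCommGroup Q]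
  (ρF : F →+ Q) (ψ : H →+ Q) (C : AddSubgroup H)

/-- **The count (C) as algebra.** For `ρ = ρ_F ∘ fst + (k·ψ)|_C ∘ snd : F × C →+ Q` with
`C ⊓ ker ψ = ⊥` (transversality) and `ρ_F(F) ⊆ (k·ψ)(C)` (e.g. `(k·ψ)|_C` onto):
**`#ker ρ = #F · #C[k]`.** In (C): `#(A₀ ⧸ S₀) = (∏_{ℓ≠p} p^{ord_p c_ℓ}) · #C_∞[p^ν] = p^ν · Tam(W)^{(p)}`
GIVEN B2 (image = `ker ρ`, via B5 + B6), B4 (`#F`), B3 (`#C_∞[p^ν] = p^ν`).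
[cite: GreenbergLNM1716, §4 (pp. 98–103)] [cite: Kobayashi2003, Thm. 6.2 (p. 11), Thm. 9.3 (p. 26)] -/
theorem natCard_ker_eq_card_mul_natCard_torsionBy (hC : C ⊓ ψ.ker = ⊥) (k : ℕ)
    (h : ∀ f : F, ∃ c : C, ρF f = k • ψ c) :
    Nat.card ((ρF.comp (AddMonoidHom.fst F C)) +
        (((k • ψ).comp C.subtype).comp (AddMonoidHom.snd F C))).ker =
      Nat.card F * Nat.card (AddSubgroup.torsionBy C k) := by
  set ρ := (ρF.comp (AddMonoidHom.fst F C)) + (((k • ψ).comp C.subtype).comp (AddMonoidHom.snd F C))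
    with hρ
  have hinr : ρ.comp (AddMonoidHom.inr F C) = (k • ψ).comp C.subtype := by
    ext c
    simp [hρ]
  rw [natCard_ker_eq_card_mul_natCard_ker_inr ρ, hinr, natCard_ker_nsmul_comp_subtype_eq ψ C hC k]
  intro f
  obtain ⟨c, hc⟩ := h f
  refine ⟨c, ?_⟩
  simp [hρ, hc]

end Combined

end DefectCount

end Summit.BirchSwinnertonDyer.Rank1Residual.Additive
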